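import Summits.BirchSwinnertonDyer.Rank1Residual.SecondDescent.BSDpFromSecondDescentOneNonempty
import HarnessLib

/-!
# B-1 second-3-descent `NONEMPTY × 1` record SHAPES for a literal model, `Ш` currency (ONE witness on an independent `Sel₃` pair; X8 / X7 / X6 with either upper half; X4 with Kato's) (cell `b2b-bsdres`, CLASS-CLOSURE instrument seat cc-eng-4, GEN 11)

HONEST FRAMING (run/shared/lean/b2b/bsd-rank1-residual/, verbatim in every file): the goal of the
cell is to DELETE the COMBINATION-SHAPED residual classes of the Birch–Swinnerton-Dyer formula for
ALL analytic-rank `≤ 1` elliptic curves over `ℚ` — "full BSD formula for every rank `≤ 1` curve in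
class `C`" assembled STRICTLY from published theorems — so that the rank-`≤ 1` remainder becomes
exactly the CONSTRUCTION-SHAPED classes, which are TYPED (missing-input `Prop`s), NOT attempted.
This is not "finishing BSD". Classes X4 / X6 / X7 / X8 stay as the map has them (X6 ANNOUNCED,
BSTW); these are per-pair record SHAPES (certificate consumers); the second-descent outputs that
instantiate them are INSTRUMENTATION (class-closure E4) / EVIDENCE under census-lead's tier label;
no lane verdict is changed; no named fact is added; nothing is booked by this unit. THEOREMS ONLY
(no definition, no named fact, no `sorry`).

## What this file does

`NonemptyRecordShapesCardFree.lean` (GEN 11) gives the literal-model `Ш`-currency record shapes with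
TWO second-descent witnesses and no `#Ш[3] = 9` binder.  `ShaDivisibleFromTwoNonempty.lean`
Appendix B + `BSDpFromSecondDescentOneNonempty.lean` (GEN 11) show that ONE witness on an
independent pair already gives `3³ ∣ #Ш`, which is exactly what the Cassels–Tate parity step
consumes.  This file restates the SEVEN literal-model shapes with ONE witness: binders
`{c₁ c₂ d} (h1 : 3 • c₁ = 0) (h2 : 3 • c₂ = 0) (hc₁ : c₁ ≠ 0) (hind : c₂ ∉ ℤ∙c₁) (hd : 3 • d = c₁)`
— `c₂` needs no divisibility witness and there is no `hcard`.  What it buys a record filer: a row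
of W-item 6 (`production-staged-g7`, 44 rows) or any later B-1 `NONEMPTY` target is certified as
soon as ONE of its two cubics returns `NONEMPTY(witness)` on the engines (the other may time out /
be refused / abort), given the front's two independent `Sel₃` cubics and the analytic data; a MIXED
`NONEMPTY` + certified `EMPTY` outcome on an independent pair contradicts the Cassels–Tate structure
and is an ANOMALY to report, never a certificate.  Per pair; classes unchanged; nothing booked.
References as in the parent files: [Wuthrich2014] Prop. 21, [PerrinRiou2003] Prop. 4.8,
[Kato2004Asterisque] Thm. 14.5 (3), [Creutz2014] §1/§7, [SilvermanAEC2009] X.4.14, [Miller2011LMS]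
§1, [Serre1972].
-/

set_option autoImplicit false

noncomputable section

open scoped Classical

open WeierstrassCurve Literature.NumberTheory.EllipticCurves
  Literature.NumberTheory.EllipticCurves.ModularForms
  Literature.NumberTheory.EllipticCurves.Rank1Residual
  Literature.NumberTheory.EllipticCurves.Rank1Residual.Typed
  Literature.NumberTheory.EllipticCurves.Rank1Residual.X11RankOneCertificates
  Literature.NumberTheory.EllipticCurves.Wuthrich2014
  Literature.NumberTheory.EllipticCurves.PerrinRiou2003
  Summit.BirchSwinnertonDyer.Rank1Residual.Additive
  Summit.BirchSwinnertonDyer.Rank1Residual.X11b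

namespace Summit.BirchSwinnertonDyer.Rank1Residual.SecondDescent

/-! ### §1. Wuthrich upper half (`hW`), ONE witness -/

/-- **X8 ∩ {r_an = 0} ∩ {surj(3)}, literal model, `Ш` currency, ONE witness**: Wuthrich +
Cassels–Tate + GZK + modularity + [X8 at `3`, `ρ̄_{E,3}` onto, `r_an = 0`] + two `3`-torsion classes
`c₁ ≠ 0`, `c₂ ∉ ℤ∙c₁` of `Ш` with `c₁` a third multiple + `ord₃ #Ш_an ≤ 4` ⟹ `BSD(E,3)`
(`X8.bsdp_three_rankZero_of_casselsTate_of_one_nonempty_of_surj` on the literal data).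
Per pair; class X8 unchanged; nothing booked. [cite: Wuthrich2014, Prop. 21 (p. 400)]
[cite: SilvermanAEC2009, Thm. X.4.14] [cite: Creutz2014, §1] [cite: Miller2011LMS, §1 and Def. 1.1] -/
theorem X8.bsdp_three_rankZero_of_ainvs_of_casselsTate_of_one_nonempty_of_surj
    (hCT : exists_casselsTate_pairing (K := ℚ)) (hW : sha_dvd_analyticSha)
    (hGZK : rank_eq_analyticRank_of_analyticRank_le_one) (hmod : hasEntireLFunction_rat)
    (a1 a2 a3 a4 a6 : ℤ) (hΔ : discOf [a1, a2, a3, a4, a6] ≠ 0)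
    (hmin : (⟨a1, a2, a3, a4, a6⟩ : WeierstrassCurve ℚ).IsGloballyMinimal)
    (hX : haveI := hmin; ClassX8 (⟨a1, a2, a3, a4, a6⟩ : WeierstrassCurve ℚ) 3)
    (hs : Surj (⟨a1, a2, a3, a4, a6⟩ : WeierstrassCurve ℚ) 3)
    (hr : (⟨a1, a2, a3, a4, a6⟩ : WeierstrassCurve ℚ).analyticRank = 0)
    {c₁ c₂ d : (⟨a1, a2, a3, a4, a6⟩ : WeierstrassCurve ℚ).sha} (h1 : 3 • c₁ = 0)
    (h2 : 3 • c₂ = 0) (hc₁ : c₁ ≠ 0) (hind : c₂ ∉ AddSubgroup.zmultiples c₁) (hd : 3 • d = c₁)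
    {q : ℚ} (hq : shaAn (⟨a1, a2, a3, a4, a6⟩ : WeierstrassCurve ℚ) = (q : ℂ))
    (hv : padicValRat 3 q ≤ 4) : BSDp (⟨a1, a2, a3, a4, a6⟩ : WeierstrassCurve ℚ) 3 := by
  haveI := isElliptic_of_discOf_ne_zero a1 a2 a3 a4 a6 hΔ
  haveI := hmin
  exact X8.bsdp_three_rankZero_of_casselsTate_of_one_nonempty_of_surj hCT hW hGZK hmod _ hX hs hr
    h1 h2 hc₁ hind hd hq hv

/-- **X7 ∩ {r_an = 0}, surj(3), literal model, `Ш` currency, ONE witness**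
(`X7.bsdp_three_rankZero_of_casselsTate_of_one_nonempty_of_surj` on the literal data).
Per pair; class X7 unchanged; nothing booked. [cite: Wuthrich2014, Prop. 21 (p. 400)]
[cite: SilvermanAEC2009, Thm. X.4.14] [cite: Creutz2014, §1] [cite: Miller2011LMS, §1 and Def. 1.1] -/
theorem X7.bsdp_three_rankZero_of_ainvs_of_casselsTate_of_one_nonempty_of_surj
    (hCT : exists_casselsTate_pairing (K := ℚ)) (hW : sha_dvd_analyticSha)
    (hGZK : rank_eq_analyticRank_of_analyticRank_le_one) (hmod : hasEntireLFunction_rat)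
    (a1 a2 a3 a4 a6 : ℤ) (hΔ : discOf [a1, a2, a3, a4, a6] ≠ 0)
    (hmin : (⟨a1, a2, a3, a4, a6⟩ : WeierstrassCurve ℚ).IsGloballyMinimal)
    (hX : haveI := hmin; ClassX7 (⟨a1, a2, a3, a4, a6⟩ : WeierstrassCurve ℚ) 3)
    (hs : Surj (⟨a1, a2, a3, a4, a6⟩ : WeierstrassCurve ℚ) 3)
    (hr : (⟨a1, a2, a3, a4, a6⟩ : WeierstrassCurve ℚ).analyticRank = 0)
    {c₁ c₂ d : (⟨a1, a2, a3, a4, a6⟩ : WeierstrassCurve ℚ).sha} (h1 : 3 • c₁ = 0)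
    (h2 : 3 • c₂ = 0) (hc₁ : c₁ ≠ 0) (hind : c₂ ∉ AddSubgroup.zmultiples c₁) (hd : 3 • d = c₁)
    {q : ℚ} (hq : shaAn (⟨a1, a2, a3, a4, a6⟩ : WeierstrassCurve ℚ) = (q : ℂ))
    (hv : padicValRat 3 q ≤ 4) : BSDp (⟨a1, a2, a3, a4, a6⟩ : WeierstrassCurve ℚ) 3 := by
  haveI := isElliptic_of_discOf_ne_zero a1 a2 a3 a4 a6 hΔ
  haveI := hmin
  exact X7.bsdp_three_rankZero_of_casselsTate_of_one_nonempty_of_surj hCT hW hGZK hmod _ hX hs hr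
    h1 h2 hc₁ hind hd hq hv

/-- **X6 ∩ {r_an = 0}, literal model, `Ш` currency, ONE witness** (image proviso automatic)
(`X6.bsdp_three_rankZero_of_casselsTate_of_one_nonempty` on the literal data). The N4@3 canary rows
`271726d1 / 405130d1 / 152330l1` (certified × 2, records `bsdp3_b1n_·` p305257) are EVIDENCE
pointers; this is their fallback shape. Per pair; class X6
unchanged; nothing booked. [cite: Wuthrich2014, Prop. 21 (p. 400)] [cite: SilvermanAEC2009, Thm. X.4.14]
[cite: Creutz2014, §1] [cite: Miller2011LMS, §1 and Def. 1.1] -/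
theorem X6.bsdp_three_rankZero_of_ainvs_of_casselsTate_of_one_nonempty
    (hCT : exists_casselsTate_pairing (K := ℚ)) (hW : sha_dvd_analyticSha)
    (hGZK : rank_eq_analyticRank_of_analyticRank_le_one) (hmod : hasEntireLFunction_rat)
    (a1 a2 a3 a4 a6 : ℤ) (hΔ : discOf [a1, a2, a3, a4, a6] ≠ 0)
    (hmin : (⟨a1, a2, a3, a4, a6⟩ : WeierstrassCurve ℚ).IsGloballyMinimal)
    (hX : haveI := hmin; ClassX6 (⟨a1, a2, a3, a4, a6⟩ : WeierstrassCurve ℚ) 3)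
    (hr : (⟨a1, a2, a3, a4, a6⟩ : WeierstrassCurve ℚ).analyticRank = 0)
    {c₁ c₂ d : (⟨a1, a2, a3, a4, a6⟩ : WeierstrassCurve ℚ).sha} (h1 : 3 • c₁ = 0)
    (h2 : 3 • c₂ = 0) (hc₁ : c₁ ≠ 0) (hind : c₂ ∉ AddSubgroup.zmultiples c₁) (hd : 3 • d = c₁)
    {q : ℚ} (hq : shaAn (⟨a1, a2, a3, a4, a6⟩ : WeierstrassCurve ℚ) = (q : ℂ))
    (hv : padicValRat 3 q ≤ 4) : BSDp (⟨a1, a2, a3, a4, a6⟩ : WeierstrassCurve ℚ) 3 := by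
  haveI := isElliptic_of_discOf_ne_zero a1 a2 a3 a4 a6 hΔ
  haveI := hmin
  exact X6.bsdp_three_rankZero_of_casselsTate_of_one_nonempty hCT hW hGZK hmod _ hX hr h1 h2 hc₁
    hind hd hq hv

/-! ### §2. Perrin-Riou Prop. 4.8 upper half (`h48`), ONE witness -/

/-- **X8 ∩ {r_an = 0} ∩ {surj(3)}, literal model, `Ш` currency, upper half from Prop. 4.8, ONE
witness** (`X8.bsdp_three_rankZero_of_casselsTate_of_one_nonempty_of_prop48_of_surj` on the literal
data). Per pair; class X8 unchanged; nothing booked.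
[cite: PerrinRiou2003, Prop. 4.8 (p. 162)] [cite: Wuthrich2014, Lemma 20 (p. 399)]
[cite: SilvermanAEC2009, Thm. X.4.14] [cite: Creutz2014, §1] [cite: Miller2011LMS, §1 and Def. 1.1] -/
theorem X8.bsdp_three_rankZero_of_ainvs_of_casselsTate_of_one_nonempty_of_prop48_of_surj
    (hCT : exists_casselsTate_pairing (K := ℚ)) (h48 : prop48_padicValRat_bsd_rank_zero_le)
    (hGZK : rank_eq_analyticRank_of_analyticRank_le_one) (hmod : hasEntireLFunction_rat)
    (a1 a2 a3 a4 a6 : ℤ) (hΔ : discOf [a1, a2, a3, a4, a6] ≠ 0)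
    (hmin : (⟨a1, a2, a3, a4, a6⟩ : WeierstrassCurve ℚ).IsGloballyMinimal)
    (hX : haveI := hmin; ClassX8 (⟨a1, a2, a3, a4, a6⟩ : WeierstrassCurve ℚ) 3)
    (hs : Surj (⟨a1, a2, a3, a4, a6⟩ : WeierstrassCurve ℚ) 3)
    (hr : (⟨a1, a2, a3, a4, a6⟩ : WeierstrassCurve ℚ).analyticRank = 0)
    {c₁ c₂ d : (⟨a1, a2, a3, a4, a6⟩ : WeierstrassCurve ℚ).sha} (h1 : 3 • c₁ = 0)
    (h2 : 3 • c₂ = 0) (hc₁ : c₁ ≠ 0) (hind : c₂ ∉ AddSubgroup.zmultiples c₁) (hd : 3 • d = c₁)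
    {q : ℚ} (hq : shaAn (⟨a1, a2, a3, a4, a6⟩ : WeierstrassCurve ℚ) = (q : ℂ))
    (hv : padicValRat 3 q ≤ 4) : BSDp (⟨a1, a2, a3, a4, a6⟩ : WeierstrassCurve ℚ) 3 := by
  haveI := isElliptic_of_discOf_ne_zero a1 a2 a3 a4 a6 hΔ
  haveI := hmin
  exact X8.bsdp_three_rankZero_of_casselsTate_of_one_nonempty_of_prop48_of_surj hCT h48 hGZK hmod _
    hX hs hr h1 h2 hc₁ hind hd hq hv

/-- **X7 ∩ {r_an = 0}, surj(3), literal model, `Ш` currency, upper half from Prop. 4.8, ONE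
witness** (`X7.…_of_one_nonempty_of_prop48_of_surj` on the literal data). Per pair; class X7
unchanged; nothing booked. [cite: PerrinRiou2003, Prop. 4.8 (p. 162)] [cite: Wuthrich2014, Lemma 20 (p. 399)]
[cite: SilvermanAEC2009, Thm. X.4.14] [cite: Creutz2014, §1] [cite: Miller2011LMS, §1 and Def. 1.1] -/
theorem X7.bsdp_three_rankZero_of_ainvs_of_casselsTate_of_one_nonempty_of_prop48_of_surj
    (hCT : exists_casselsTate_pairing (K := ℚ)) (h48 : prop48_padicValRat_bsd_rank_zero_le)
    (hGZK : rank_eq_analyticRank_of_analyticRank_le_one) (hmod : hasEntireLFunction_rat)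
    (a1 a2 a3 a4 a6 : ℤ) (hΔ : discOf [a1, a2, a3, a4, a6] ≠ 0)
    (hmin : (⟨a1, a2, a3, a4, a6⟩ : WeierstrassCurve ℚ).IsGloballyMinimal)
    (hX : haveI := hmin; ClassX7 (⟨a1, a2, a3, a4, a6⟩ : WeierstrassCurve ℚ) 3)
    (hs : Surj (⟨a1, a2, a3, a4, a6⟩ : WeierstrassCurve ℚ) 3)
    (hr : (⟨a1, a2, a3, a4, a6⟩ : WeierstrassCurve ℚ).analyticRank = 0)
    {c₁ c₂ d : (⟨a1, a2, a3, a4, a6⟩ : WeierstrassCurve ℚ).sha} (h1 : 3 • c₁ = 0)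
    (h2 : 3 • c₂ = 0) (hc₁ : c₁ ≠ 0) (hind : c₂ ∉ AddSubgroup.zmultiples c₁) (hd : 3 • d = c₁)
    {q : ℚ} (hq : shaAn (⟨a1, a2, a3, a4, a6⟩ : WeierstrassCurve ℚ) = (q : ℂ))
    (hv : padicValRat 3 q ≤ 4) : BSDp (⟨a1, a2, a3, a4, a6⟩ : WeierstrassCurve ℚ) 3 := by
  haveI := isElliptic_of_discOf_ne_zero a1 a2 a3 a4 a6 hΔ
  haveI := hmin
  exact X7.bsdp_three_rankZero_of_casselsTate_of_one_nonempty_of_prop48_of_surj hCT h48 hGZK hmod _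
    hX hs hr h1 h2 hc₁ hind hd hq hv

/-- **X6 ∩ {r_an = 0}, literal model, `Ш` currency, upper half from Prop. 4.8, NO image binder,
ONE witness** (`X6.…_of_one_nonempty_of_prop48` on the literal data). EVIDENCE pointers: the N4@3
canary rows. Per pair; class X6 unchanged; nothing booked. [cite: PerrinRiou2003, Prop. 4.8 (p. 162)]
[cite: Serre1972, §5.4 Prop. 21 i)] [cite: SilvermanAEC2009, Thm. X.4.14] [cite: Creutz2014, §1]
[cite: Miller2011LMS, §1 and Def. 1.1] -/
theorem X6.bsdp_three_rankZero_of_ainvs_of_casselsTate_of_one_nonempty_of_prop48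
    (hCT : exists_casselsTate_pairing (K := ℚ)) (h48 : prop48_padicValRat_bsd_rank_zero_le)
    (hGZK : rank_eq_analyticRank_of_analyticRank_le_one) (hmod : hasEntireLFunction_rat)
    (a1 a2 a3 a4 a6 : ℤ) (hΔ : discOf [a1, a2, a3, a4, a6] ≠ 0)
    (hmin : (⟨a1, a2, a3, a4, a6⟩ : WeierstrassCurve ℚ).IsGloballyMinimal)
    (hX : haveI := hmin; ClassX6 (⟨a1, a2, a3, a4, a6⟩ : WeierstrassCurve ℚ) 3)
    (hr : (⟨a1, a2, a3, a4, a6⟩ : WeierstrassCurve ℚ).analyticRank = 0)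
    {c₁ c₂ d : (⟨a1, a2, a3, a4, a6⟩ : WeierstrassCurve ℚ).sha} (h1 : 3 • c₁ = 0)
    (h2 : 3 • c₂ = 0) (hc₁ : c₁ ≠ 0) (hind : c₂ ∉ AddSubgroup.zmultiples c₁) (hd : 3 • d = c₁)
    {q : ℚ} (hq : shaAn (⟨a1, a2, a3, a4, a6⟩ : WeierstrassCurve ℚ) = (q : ℂ))
    (hv : padicValRat 3 q ≤ 4) : BSDp (⟨a1, a2, a3, a4, a6⟩ : WeierstrassCurve ℚ) 3 := by
  haveI := isElliptic_of_discOf_ne_zero a1 a2 a3 a4 a6 hΔ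
  haveI := hmin
  exact X6.bsdp_three_rankZero_of_casselsTate_of_one_nonempty_of_prop48 hCT h48 hGZK hmod _ hX hr
    h1 h2 hc₁ hind hd hq hv

/-! ### §3. X4 (additive at `3`, potentially good, `ρ̄_{E,9}` onto), Kato's upper half, ONE witness -/

/-- **X4 `NONEMPTY × 2` reading for a literal model, `p = 3`, analytic rank `0`, `ρ̄_{E,9}` onto, ONE
witness** (`X4RankZero.bsdp_three_of_kato_of_surj9_of_casselsTate_of_one_nonempty` on the literal
data): Kato's upper half + GZK + modularity + Cassels–Tate + [X4 at `3`, `r_an = 0`, `ord₃ j ≥ 0`,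
surj(9), `3 ∤ ∏ c_ℓ`, `3 ∤ c_D`] + two `3`-torsion classes `c₁ ≠ 0`, `c₂ ∉ ℤ∙c₁` of `Ш` with `c₁`
a third multiple + `ord₃ #Ш_an ≤ 4` ⟹ `BSD(E,3)`. Fallback shape of the window row `19215t1`.
Per pair; class X4 unchanged; nothing booked. [cite: Kato2004Asterisque, Thm. 14.5 (3) (p. 236)]
[cite: SilvermanAEC2009, Thm. X.4.14] [cite: Creutz2014, §1] [cite: Miller2011LMS, §1 and Def. 1.1] -/
theorem X4RankZero.bsdp_three_of_ainvs_of_kato_of_surj9_of_casselsTate_of_one_nonempty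
    (hKato : Kato2004.rankZero_padicValNat_sha_le_of_additive_potGood_of_imageContainsSL2)
    (hGZK : rank_eq_analyticRank_of_analyticRank_le_one) (hmod : hasEntireLFunction_rat)
    (hCT : exists_casselsTate_pairing (K := ℚ))
    (a1 a2 a3 a4 a6 : ℤ) (hΔ : discOf [a1, a2, a3, a4, a6] ≠ 0)
    (hmin : (⟨a1, a2, a3, a4, a6⟩ : WeierstrassCurve ℚ).IsGloballyMinimal)
    (hr : (⟨a1, a2, a3, a4, a6⟩ : WeierstrassCurve ℚ).analyticRank = 0)
    (hX : ClassX4 (⟨a1, a2, a3, a4, a6⟩ : WeierstrassCurve ℚ) 3)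
    (hpot : haveI := isElliptic_of_discOf_ne_zero a1 a2 a3 a4 a6 hΔ
      0 ≤ padicValRat 3 (⟨a1, a2, a3, a4, a6⟩ : WeierstrassCurve ℚ).j)
    (h9 : (⟨a1, a2, a3, a4, a6⟩ : WeierstrassCurve ℚ).HasSurjectiveModNGaloisRep 9)
    (htam : ¬ 3 ∣ (⟨a1, a2, a3, a4, a6⟩ : WeierstrassCurve ℚ).tamagawaProduct)
    {N : ℕ} [NeZero N] (D : ModularParametrizationData (⟨a1, a2, a3, a4, a6⟩ : WeierstrassCurve ℚ) N)
    (hc : ¬ (3 : ℤ) ∣ D.maninConstant)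
    {c₁ c₂ d : (⟨a1, a2, a3, a4, a6⟩ : WeierstrassCurve ℚ).sha} (h1 : 3 • c₁ = 0)
    (h2 : 3 • c₂ = 0) (hc₁ : c₁ ≠ 0) (hind : c₂ ∉ AddSubgroup.zmultiples c₁) (hd : 3 • d = c₁)
    {q : ℚ} (hq : shaAn (⟨a1, a2, a3, a4, a6⟩ : WeierstrassCurve ℚ) = (q : ℂ))
    (hv : padicValRat 3 q ≤ 4) : BSDp (⟨a1, a2, a3, a4, a6⟩ : WeierstrassCurve ℚ) 3 := by
  haveI := isElliptic_of_discOf_ne_zero a1 a2 a3 a4 a6 hΔ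
  haveI := hmin
  exact X4RankZero.bsdp_three_of_kato_of_surj9_of_casselsTate_of_one_nonempty _ hKato hGZK hmod hCT
    hr hX hpot h9 htam D hc h1 h2 hc₁ hind hd hq hv

end Summit.BirchSwinnertonDyer.Rank1Residual.SecondDescent

end
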